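import Mathlib
import Summits.AtomisticToContinuum.Crystallization.Theses.PhononSlackCertificates
import Summits.AtomisticToContinuum.Crystallization.Theorems.PhononSlackCertificatesNearFieldConvexityLayeredThreshold
import Summits.AtomisticToContinuum.Crystallization.Theorems.PhononSlackCertificatesNearFieldConvexityThresholdOfFlat

/-!
# Route `PhononSlackCertificates`, crux `NearFieldConvexity` (stmt-AtomisticToContinuum-13958), line `Sketch`:
the summed squared threshold estimate (I_sq) from PAID AFFINE FLATNESS WITNESSES (piece R1 of the stub
`stub_thresholdSqPaid`)

The stub `stub_thresholdSqPaid` (I_sq) of skeleton v22 asks, for SOME goodness tolerance `ε₁ ∈ [1/100, 1/20]` and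
every `δ > 0`, for constants `K ≥ 0`, `C` with

`Σ_{i ∈ int₈Ω} θ(i)² ≤ K · [E_self(Ω) − |Ω|·e*] + C · #∂₄Ω`

on every `δ`-separated configuration and every finite set `Ω` of `ε₁`-good particles (carrying `2/5`-charts at its
radius-3 interior sites), where `θ(i) = sInf {e ≥ 0 : the 2-ball of x i is e-layered}` is the layeredness threshold
(toolkit `…NearFieldConvexityLayeredThreshold`).  This file reduces (I_sq) to the statement (I_flat) written in the
vocabulary of the twin crux `NashClassCertificates.NashNearField` (its summed Cauchy–Born coercivity B″): for the
same `ε₁, δ, K, C` and every such `Ω` there are, at the radius-8 interior sites `i`, a Hägg word `sW i`, an affine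
part `Gw i` (bi-Lipschitz `4/5, 6/5`) and a tolerance `νw i ≥ 0` making the 3-ball of `x i` two-way `νw i`-matched
with `x i + Gw i (T_{sW i})` (the three flatness clauses of B″, verbatim), together with a box cell
`(Aw i, aw i, hw i)` of the family that is `rw i`-close to `Gw i` on the unit-template sites of norm `≤ 3`, such
that the quadratic flatness bill is paid linearly:

`Σ_{i ∈ int₈Ω} (2400 (νw i)² + 800 (rw i)²) ≤ K · [E_self(Ω) − |Ω|·e*] + C · #∂₄Ω`.

Proof (`stub_thresholdSqOfFlatness`): at every radius-8 interior site the landed squared threshold bound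
`threshold_sq_le_of_flat` (`…NearFieldConvexityThresholdOfFlat`) gives `θ(i)² ≤ 2400 (νw i)² + 800 (rw i)²`;
sum over the interior (`Finset.sum_le_sum`).  The chart hypothesis of (I_sq) is not needed (charts are theorems:
`chart_of_stubs_radius`).  `[folklore]`.
-/

noncomputable section

open scoped BigOperators
open Literature.MathematicalPhysics.StatisticalMechanics Literature.Geometry.DiscreteGeometry

namespace Summit.AtomisticToContinuum.Crystallization.Theorems.PhononSlackNearFieldConvexity

/-- **Registered piece `stub_thresholdSqOfFlatness` (R1 of `stub_thresholdSqPaid`): (I_flat) ⇒ (I_sq).**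
If for some `ε₁ ∈ [1/100, 1/20]` and every `δ > 0` there are `K ≥ 0`, `C` such that every finite set `Ω` of
`ε₁`-good particles of a `δ`-separated configuration admits, at its radius-8 interior sites, Hägg words `sW i`,
affine flatness witnesses `(Gw i, νw i)` (3-ball two-way `νw i`-matched with `x i + Gw i (barlowPos 1 (√6/3) (sW i))`,
`Gw i` bi-Lipschitz `4/5, 6/5`) and box cells `(Aw i, aw i, hw i)` that are `rw i`-close to `Gw i` on the unit
sites of norm `≤ 3`, with `Σ_{int₈Ω} (2400 (νw i)² + 800 (rw i)²) ≤ K·[E_self(Ω) − |Ω|e*] + C·#∂₄Ω`, then the summed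
squared layeredness threshold is paid with the same constants:
`Σ_{int₈Ω} θ(i)² ≤ K·[E_self(Ω) − |Ω|e*] + C·#∂₄Ω` (termwise `threshold_sq_le_of_flat`). [folklore] -/
theorem stub_thresholdSqOfFlatness : (∃ ε₁ : ℝ, 1 / 100 ≤ ε₁ ∧ ε₁ ≤ 1 / 20 ∧ ∀ δ : ℝ, 0 < δ → ∃ K : ℝ, 0 ≤ K ∧ ∃ C : ℝ, ∀ (N : ℕ) (x : Fin N → EuclideanSpace ℝ (Fin 3)), (∀ i j : Fin N, i ≠ j → δ ≤ dist (x i) (x j)) → ∀ Ω : Finset (Fin N), (∀ i ∈ Ω, IsTwoShellGood ε₁ (47 / 50) 1 x i) → ∃ (sW : Fin N → ℤ → ℤ) (Gw : Fin N → (EuclideanSpace ℝ (Fin 3) →L[ℝ] EuclideanSpace ℝ (Fin 3))) (νw rw : Fin N → ℝ) (Aw : Fin N → (EuclideanSpace ℝ (Fin 3) →ₗᵢ[ℝ] EuclideanSpace ℝ (Fin 3))) (aw hw : Fin N → ℝ), (∀ i ∈ Ω, (∀ k : Fin N, dist (x k) (x i) ≤ 8 → k ∈ Ω) → IsHaggSeq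 (sW i) ∧ 0 ≤ νw i ∧ ((∀ j : Fin N, dist (x j) (x i) ≤ 3 → ∃ m u v : ℤ, dist (x j - x i) ((Gw i) (barlowPos 1 (Real.sqrt 6 / 3) (sW i) m u v)) ≤ (νw i)) ∧ (∀ m u v : ℤ, ‖(Gw i) (barlowPos 1 (Real.sqrt 6 / 3) (sW i) m u v)‖ ≤ 3 → ∃ j : Fin N, dist (x j - x i) ((Gw i) (barlowPos 1 (Real.sqrt 6 / 3) (sW i) m u v)) ≤ (νw i)) ∧ (∀ p : EuclideanSpace ℝ (Fin 3), 4 / 5 * ‖p‖ ≤ ‖(Gw i) p‖ ∧ ‖(Gw i) p‖ ≤ 6 / 5 * ‖p‖)) ∧ 47 / 50 ≤ aw i ∧ aw i ≤ 1 ∧ 39 / 50 * aw i ≤ hw i ∧ hw i ≤ 17 / 20 * aw i ∧ (∀ m u v : ℤ, ‖barlowPos 1 (Real.sqrt 6 / 3) (sW i) m u v‖ ≤ 3 → dist ((Gw i) (barlowPos 1 (Real.sqrt 6 / 3) (sW i) m u v)) ((Aw i) (barlowPos (aw i) (hw i) (sW i) m u v)) < rw i)) ∧ (∑ i ∈ Ω.filter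 (fun i => ∀ k : Fin N, dist (x k) (x i) ≤ 8 → k ∈ Ω), (2400 * (νw i) ^ 2 + 800 * (rw i) ^ 2)) ≤ K * ((∑ i ∈ Ω, (1 / 2 : ℝ) * (∑ j ∈ Ω.erase i, lennardJones (dist (x i) (x j)))) - (Ω.card : ℝ) * (⨅ Q : PeriodicConfiguration 3, Q.energyPerParticle lennardJones)) + C * (Nat.card {i : Fin N // i ∈ Ω ∧ ∃ j : Fin N, j ∉ Ω ∧ dist (x j) (x i) ≤ 4} : ℝ)) → ∃ ε₁ : ℝ, 1 / 100 ≤ ε₁ ∧ ε₁ ≤ 1 / 20 ∧ ∀ δ : ℝ, 0 < δ → ∃ K : ℝ, 0 ≤ K ∧ ∃ C : ℝ, ∀ (N : ℕ) (x : Fin N → EuclideanSpace ℝ (Fin 3)), (∀ i j : Fin N, i ≠ j → δ ≤ dist (x i) (x j)) → ∀ Ω : Finset (Fin N), (∀ i ∈ Ω, IsTwoShellGood ε₁ (47 / 50) 1 x i) → (∀ i ∈ Ω, (∀ k : Fin N, dist (x k) (x i) ≤ 3 → k ∈ Ω) → (∃ (A : EuclideanSpace ℝ (Fin 3) →ₗᵢ[ℝ]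 EuclideanSpace ℝ (Fin 3)) (a h : ℝ) (s : ℤ → ℤ), 47 / 50 ≤ a ∧ a ≤ 1 ∧ 39 / 50 * a ≤ h ∧ h ≤ 17 / 20 * a ∧ IsHaggSeq s ∧ (fun S : Set (EuclideanSpace ℝ (Fin 3)) => (∀ j : Fin N, dist (x j) (x i) ≤ 2 → ∃ p ∈ S, dist (x j) p ≤ 2 / 5) ∧ (∀ p ∈ S, dist p (x i) ≤ 2 → ∃ j : Fin N, dist (x j) p ≤ 2 / 5)) {p | ∃ m u v : ℤ, p = x i + A (((u : ℝ) • triangularVec₁ a) + ((v : ℝ) • triangularVec₂ a) + ((haggLabel s m : ℝ) • barlowOffset a) + ((m : ℝ) • layerNormal h))})) → (∑ i ∈ Ω.filter (fun i => ∀ k : Fin N, dist (x k) (x i) ≤ 8 → k ∈ Ω), (sInf {e : ℝ | 0 ≤ e ∧ (∃ (A : EuclideanSpace ℝ (Fin 3) →ₗᵢ[ℝ] EuclideanSpace ℝ (Fin 3)) (t : EuclideanSpace ℝ (Fin 3)) (a : ℝ) (s : ℤ → ℤ) (z : ℤ → ℝ), 47 / 50 ≤ a ∧ a ≤ 1 ∧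 IsHaggSeq s ∧ (∀ m : ℤ, 39 / 50 * a ≤ z (m + 1) - z m ∧ z (m + 1) - z m ≤ 17 / 20 * a) ∧ (fun S : Set (EuclideanSpace ℝ (Fin 3)) => (∀ j : Fin N, dist (x j) (x i) ≤ 2 → ∃ p ∈ S, dist (x j + t) p ≤ e) ∧ (∀ p ∈ S, dist p (x i + t) ≤ 2 → ∃ j : Fin N, dist (x j + t) p ≤ e)) {p | ∃ m i j : ℤ, p = A (((i : ℝ) • triangularVec₁ a) + ((j : ℝ) • triangularVec₂ a) + ((haggLabel s m : ℝ) • barlowOffset a) + (z m • layerNormal 1))})}) ^ 2) ≤ K * ((∑ i ∈ Ω, (1 / 2 : ℝ) * (∑ j ∈ Ω.erase i, lennardJones (dist (x i) (x j)))) - (Ω.card : ℝ) * (⨅ Q : PeriodicConfiguration 3, Q.energyPerParticle lennardJones)) + C * (Nat.card {i : Fin N // i ∈ Ω ∧ ∃ j : Fin N, j ∉ Ω ∧ dist (x j) (x i) ≤ 4} : ℝ) := by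
  rintro ⟨ε₁, hε₁, hε₁', hflatAll⟩
  refine ⟨ε₁, hε₁, hε₁', ?_⟩
  intro δ hδ
  obtain ⟨K, hK, C, hC⟩ := hflatAll δ hδ
  refine ⟨K, hK, C, ?_⟩
  intro N x hsep Ω hΩ _hchart
  obtain ⟨sW, Gw, νw, rw, Aw, aw, hw, hW, hsum⟩ := hC N x hsep Ω hΩ
  refine le_trans (Finset.sum_le_sum fun i hi => ?_) hsum
  rw [Finset.mem_filter] at hi
  obtain ⟨hs, hν, hflat, ha₁, ha₂, hh₁, hh₂, hclose⟩ := hW i hi.1 hi.2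
  exact threshold_sq_le_of_flat x i hs hν hflat (Aw i) ha₁ ha₂ hh₁ hh₂ hclose

end Summit.AtomisticToContinuum.Crystallization.Theorems.PhononSlackNearFieldConvexity
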